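import Summits.NavierStokesRegularity.NavierStokesRegularity.Theses.FilamentSkeletonRss

/-! Tools stubs of line `Sketch`, wave 2 (crux stmt-NavierStokesRegularity-15400): registered by `stub-add`,
each to be landed `--supports stmt-NavierStokesRegularity-15400` in its own Theorems file. -/

noncomputable section

open Set MeasureTheory Filter Topology
open Literature.Analysis.FluidPDE

namespace Summit.NavierStokesRegularity.NavierStokesRegularity.Cruxes.SkeletonEquilibrium.Sketch

set_option linter.unusedVariables false
set_option linter.dupNamespace false

/-- Tools stub T4 (`stub_lineSlipModel`): the slip of the STRAIGHT C₄ configuration at finite `Γ`. For the four lines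
`Ξ_k(σ) = √Γ P_k + σ e_k` (the C₄ orbit of `P₀ = (1,0,−10)`, `e₀ = (0,4/5,3/5)`), circulations `16πΓ`, `α = −5/8`, the
tangential component along line `0` at `Ξ₀(τ)` of (regularised Biot–Savart velocity + Leray–rotation drift) is EXACTLY
`√Γ · W_Γ(τ/√Γ)`, `W_Γ(t) = t/2 − 5/2 + 2400/(272t² − 320t + 425 + 625/(2Γ)) + 2400/(144t² + 625 + 625/(4Γ))
+ 2400/(272t² + 320t + 425 + 625/(2Γ))` — the model `W` of `stub_innerCertificate` up to the `O(1/Γ)` core terms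
(three applications of `stub_lineBiotSavart`; the self line contributes `0`). [folklore] -/
theorem stub_lineSlipModel : ∀ (P e : Fin 4 → EuclideanSpace ℝ (Fin 3)), P = ![!₂[(1 : ℝ), 0, -10], !₂[(0 : ℝ), 1, -10], !₂[(-1 : ℝ), 0, -10], !₂[(0 : ℝ), -1, -10]] → e = ![!₂[(0 : ℝ), 4 / 5, 3 / 5], !₂[(-4 / 5 : ℝ), 0, 3 / 5], !₂[(0 : ℝ), -4 / 5, 3 / 5], !₂[(4 / 5 : ℝ), 0, 3 / 5]] → ∀ (Γ τ : ℝ), 0 < Γ → inner ℝ ((∑ k : Fin 4, (Γ * (16 * Real.pi) / (4 * Real.pi)) • ∫ σ : ℝ, ((‖(Real.sqrt Γ • P 0 + τ • e 0) - (Real.sqrt Γ • P k + σ • e k)‖ ^ 2 + 1) ^ (3 / 2 : ℝ))⁻¹ • Literature.Analysis.FluidPDE.cross (e k) ((Real.sqrt Γ • P 0 + τ • e 0) - (Real.sqrt Γ • P k + σ • e k))) + (1 / 2 : ℝ) • (Real.sqrt Γ • P 0 + τ • e 0) - (-5 / 8 : ℝ) • Literature.Analysis.FluidPDE.cross (EuclideanSpace.single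 (2 : Fin 3) (1 : ℝ)) (Real.sqrt Γ • P 0 + τ • e 0)) (e 0) = Real.sqrt Γ * ((τ / Real.sqrt Γ) / 2 - 5 / 2 + 2400 / (272 * (τ / Real.sqrt Γ) ^ 2 - 320 * (τ / Real.sqrt Γ) + 425 + 625 / (2 * Γ)) + 2400 / (144 * (τ / Real.sqrt Γ) ^ 2 + 625 + 625 / (4 * Γ)) + 2400 / (272 * (τ / Real.sqrt Γ) ^ 2 + 320 * (τ / Real.sqrt Γ) + 425 + 625 / (2 * Γ))) := by
  sorry

/-- Tools stub T5 (`stub_forcedShooting`): global solvability of the frozen-field filament ODE. For every `η, α`, every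
CONTINUOUS forcing `U : ℝ → ℝ³` and Cauchy data `(P, e)` with `‖e‖ = 1` there is a `C²` curve `X : ℝ → ℝ³` with `X 0 = P`,
`X′ 0 = e`, unit speed, solving `X″ = η X′ × (½X − α e₃×X + U(t))` on all of `ℝ`; and it is unique among `C²` unit-speed
curves with the same data solving the same equation. (Phase-space field `(v, η v×(Ay+U t))` is locally Lipschitz,
continuous in `t`; `‖v‖ ≡ 1` is conserved (`⟨v,v′⟩ = 0`), so `‖X t‖ ≤ ‖P‖ + |t|` — global existence from the a priori
bound, tree `Literature.Analysis.ODE.exists_solution_of_apriori_bound`, both time directions glued at `0`.) [folklore] -/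
theorem stub_forcedShooting : ∀ (η α : ℝ) (U : ℝ → EuclideanSpace ℝ (Fin 3)) (P e : EuclideanSpace ℝ (Fin 3)), Continuous U → ‖e‖ = 1 → (∃ X : ℝ → EuclideanSpace ℝ (Fin 3), ContDiff ℝ 2 X ∧ X 0 = P ∧ deriv X 0 = e ∧ (∀ t, ‖deriv X t‖ = 1) ∧ ∀ t, iteratedDeriv 2 X t = η • Literature.Analysis.FluidPDE.cross (deriv X t) ((1 / 2 : ℝ) • X t - α • Literature.Analysis.FluidPDE.cross (EuclideanSpace.single (2 : Fin 3) (1 : ℝ)) (X t) + U t)) ∧ (∀ X Y : ℝ → EuclideanSpace ℝ (Fin 3), ContDiff ℝ 2 X → ContDiff ℝ 2 Y → X 0 = P → Y 0 = P → deriv X 0 = e → deriv Y 0 = e → (∀ t, iteratedDeriv 2 X t = η • Literature.Analysis.FluidPDE.cross (deriv X t) ((1 / 2 : ℝ) • X t - α • Literature.Analysis.FluidPDE.cross (EuclideanSpace.single (2 : Fin 3) (1 : ℝ)) (X t) + U t)) → (∀ t, iteratedDeriv 2 Y t = η • Literature.Analysis.FluidPDE.cross (deriv Y t) ((1 / 2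 : ℝ) • Y t - α • Literature.Analysis.FluidPDE.cross (EuclideanSpace.single (2 : Fin 3) (1 : ℝ)) (Y t) + U t)) → X = Y) := by
  sorry

/-- Tools stub T6 (`stub_forcedSlopeLaw`): the slope law with forcing. Along a `C²` unit-speed solution of
`X″ = η X′ × (V(X) + U)`, `V y = ½y − α e₃×y`, the drift slip `g = ⟨X′, V(X)⟩` satisfies the EXACT identity
`g′ = ½ − η ⟨U, X′ × V(X)⟩` (so `g′ = ½` where the forcing vanishes — `stub_outerSlopeHalf` — and `|g′ − ½| ≤ η‖U‖‖V(X)‖`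
in general: no spurious far-field stagnation when `η‖U‖‖V(X)‖ < ½`). [folklore] -/
theorem stub_forcedSlopeLaw : ∀ (η α : ℝ) (U : ℝ → EuclideanSpace ℝ (Fin 3)) (X : ℝ → EuclideanSpace ℝ (Fin 3)), ContDiff ℝ 2 X → (∀ t, ‖deriv X t‖ = 1) → (∀ t, iteratedDeriv 2 X t = η • Literature.Analysis.FluidPDE.cross (deriv X t) ((1 / 2 : ℝ) • X t - α • Literature.Analysis.FluidPDE.cross (EuclideanSpace.single (2 : Fin 3) (1 : ℝ)) (X t) + U t)) → ∀ t, deriv (fun s => inner ℝ (deriv X s) ((1 / 2 : ℝ) • X s - α • Literature.Analysis.FluidPDE.cross (EuclideanSpace.single (2 : Fin 3) (1 : ℝ)) (X s))) t = 1 / 2 - η * inner ℝ (U t) (Literature.Analysis.FluidPDE.cross (deriv X t) ((1 / 2 : ℝ) • X t - α • Literature.Analysis.FluidPDE.cross (EuclideanSpace.single (2 : Fin 3) (1 : ℝ)) (X t))) := by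
  sorry

end Summit.NavierStokesRegularity.NavierStokesRegularity.Cruxes.SkeletonEquilibrium.Sketch
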